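import Summits.CriticalPhenomena.PercolationContinuityZ3.Theorems.PercNearOneGluingNoHeavyLowerTailSahiHubCornerCert
import Mathlib.Tactic.Ring
import HarnessLib

/-!
# `NoHeavyLowerTail` (crux stmt-CriticalPhenomena-4575), P2 — the corner-0 form is the corner-1 form of the LEVEL-REVERSED data;
# certificate form of `q₀ ≥ 0` and the assembled criterion `T₁ ⟸ two certificates`

Memo `FROM-prim-masterthm-p2-g30-CORNER-POLARISATION.md` §3, SAHI-ROUTE.md §4.57 (seat `prim-masterthm-p2`, gen 30;
`--supports stmt-CriticalPhenomena-4575`).  No `sorry`, no named facts, standard axioms.  Companion of `…SahiHubCorner`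
(`cornerQ0`, `cornerQ1`, `sahiE_three_nonneg_T1_of_corner`) and `…SahiHubCornerCert` (`cornerQ1_nonneg_of_certificate`).

* `cornerQ0_eq_cornerQ1_of_rev`, `cornerQ0_eq_cornerQ1_rev` — `q₀(f,g,h) = q₁(f∘rev, g∘rev, h∘rev)` (pure bookkeeping: the
  corner forms only see the two levels, and the certificate frame uses no monotonicity in `z`);
* `cornerQ0_nonneg_of_certificate` — the certificate form of `q₀ ≥ 0` (a `q₁`-certificate for the reversed data);
* `sahiE_three_nonneg_T1_of_certificates` — **Kahn's `C₃` for `f(z,c,a), g(z,c,b), h(z,a,b)` with an ARBITRARY finite FKG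
  co-shared block `γ`, from one certificate per corner** (memo §4: both exist in every sampled cell; the rule is open). [this work]
-/

noncomputable section

open scoped Classical

namespace Summit.CriticalPhenomena.PercolationContinuityZ3.Theorems

namespace SahiHubCorner

open Finset Literature.Combinatorics.Sahi2008

variable {α β γ : Type} [Fintype α] [Fintype β] [Fintype γ]
  {wA : α → ℝ} {wB : β → ℝ} {wC : γ → ℝ} {wZ : Fin 2 → ℝ}
  {f : Fin 2 → γ → α → ℝ} {g : Fin 2 → γ → β → ℝ} {h : Fin 2 → α → β → ℝ}

/-- **Level reversal**: the corner-0 form of `(f,g,h)` is the corner-1 form of any level-reversed copy `f' z = f (1−z)`, …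
(given by the six equations). [this work] -/
theorem cornerQ0_eq_cornerQ1_of_rev {f' : Fin 2 → γ → α → ℝ} {g' : Fin 2 → γ → β → ℝ} {h' : Fin 2 → α → β → ℝ}
    (hf0 : f' 0 = f 1) (hf1 : f' 1 = f 0) (hg0 : g' 0 = g 1) (hg1 : g' 1 = g 0) (hh0 : h' 0 = h 1) (hh1 : h' 1 = h 0) :
    cornerQ0 wA wB wC f g h = cornerQ1 wA wB wC f' g' h' := by
  unfold cornerQ0 cornerQ1 cornerMixed exL F1 F2 F3
  simp only [Pi.mul_apply, hf0, hf1, hg0, hg1, hh0, hh1]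
  ring

/-- The reversed data `z ↦ f (Fin.rev z)`: `q₀(f,g,h) = q₁(f∘rev, g∘rev, h∘rev)`. [this work] -/
theorem cornerQ0_eq_cornerQ1_rev :
    cornerQ0 wA wB wC f g h = cornerQ1 wA wB wC (fun z => f z.rev) (fun z => g z.rev) (fun z => h z.rev) :=
  cornerQ0_eq_cornerQ1_of_rev rfl rfl rfl rfl rfl rfl

/-- **CERTIFICATE FORM OF `q₀ ≥ 0`**: a `q₁`-certificate (`…SahiHubCornerCert`) for the level-reversed data.  Note the roles:
`αc ≥ F̄₁`, `βc ≥ F̄₀` of the ORIGINAL data (they are `F̄₀, F̄₁` of the reversed one). [this work] -/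
theorem cornerQ0_nonneg_of_certificate [DistribLattice α] [DistribLattice β]
    (hA : IsFKGMeasure wA) (hB : IsFKGMeasure wB) (hC0 : ∀ c, 0 ≤ wC c) (hC1 : ∑ c, wC c = 1)
    (hf0 : ∀ z c a, 0 ≤ f z c a) (hg0 : ∀ z c b, 0 ≤ g z c b) (hgb : ∀ z c, Monotone (g z c))
    (hh0 : ∀ z a b, 0 ≤ h z a b) (hhb : ∀ z a, Monotone (h z a))
    {ρ lam par : Fin 2 → γ → ℝ} {αc βc κ1 κ0 : ℝ}
    (hρ : ∀ z c, 0 ≤ ρ z c) (hlam : ∀ z c, 0 ≤ lam z c) (hpar : ∀ z c, 0 ≤ par z c)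
    (hα : Fb wA wC (fun z => f z.rev) 0 ≤ αc) (hβ : Fb wA wC (fun z => f z.rev) 1 ≤ βc)
    (hPhi : ∀ b, 0 ≤ PhiC wA wC (fun z => f z.rev) (fun z => g z.rev) (fun z => h z.rev) ρ lam par αc βc κ1 κ0 b)
    (hR : 0 ≤ RC wA wB wC (fun z => f z.rev) (fun z => g z.rev) (fun z => h z.rev) ρ lam par αc βc κ1 κ0) :
    0 ≤ cornerQ0 wA wB wC f g h := by
  rw [cornerQ0_eq_cornerQ1_rev]
  exact cornerQ1_nonneg_of_certificate hA hB hC0 hC1 (fun z c a => hf0 z.rev c a) (fun z c b => hg0 z.rev c b)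
    (fun z c => hgb z.rev c) (fun z a b => hh0 z.rev a b) (fun z a => hhb z.rev a) hρ hlam hpar hα hβ hPhi hR

/-- **T₁ FROM TWO CERTIFICATES.**  For the T₁ triple `f(z,c,a), g(z,c,b), h(z,a,b)` (FKG blocks `α, β, γ`, any hub weight,
sections nonnegative and monotone in `c, a, b`): a `q₁`-certificate for the data and a `q₁`-certificate for the level-reversed data
give Kahn's `C₃` / Sahi's `E₃ ≥ 0`. [this work] -/
theorem sahiE_three_nonneg_T1_of_certificates [DistribLattice α] [DistribLattice β] [DistribLattice γ]
    (hA : IsFKGMeasure wA) (hB : IsFKGMeasure wB) (hC : IsFKGMeasure wC)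
    (hZ0 : 0 ≤ wZ 0) (hZ1 : 0 ≤ wZ 1) (hZ : wZ 0 + wZ 1 = 1)
    (hf0 : ∀ z c a, 0 ≤ f z c a) (hfa : ∀ z c, Monotone (f z c)) (hfc : ∀ z a, Monotone (fun c => f z c a))
    (hg0 : ∀ z c b, 0 ≤ g z c b) (hgb : ∀ z c, Monotone (g z c)) (hgc : ∀ z b, Monotone (fun c => g z c b))
    (hh0 : ∀ z a b, 0 ≤ h z a b) (hha : ∀ z b, Monotone (fun a => h z a b)) (hhb : ∀ z a, Monotone (h z a))
    {ρ lam par ρ' lam' par' : Fin 2 → γ → ℝ} {αc βc κ1 κ0 αc' βc' κ1' κ0' : ℝ}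
    (hρ : ∀ z c, 0 ≤ ρ z c) (hlam : ∀ z c, 0 ≤ lam z c) (hpar : ∀ z c, 0 ≤ par z c)
    (hα : Fb wA wC f 0 ≤ αc) (hβ : Fb wA wC f 1 ≤ βc)
    (hPhi : ∀ b, 0 ≤ PhiC wA wC f g h ρ lam par αc βc κ1 κ0 b) (hR : 0 ≤ RC wA wB wC f g h ρ lam par αc βc κ1 κ0)
    (hρ' : ∀ z c, 0 ≤ ρ' z c) (hlam' : ∀ z c, 0 ≤ lam' z c) (hpar' : ∀ z c, 0 ≤ par' z c)
    (hα' : Fb wA wC (fun z => f z.rev) 0 ≤ αc') (hβ' : Fb wA wC (fun z => f z.rev) 1 ≤ βc')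
    (hPhi' : ∀ b, 0 ≤ PhiC wA wC (fun z => f z.rev) (fun z => g z.rev) (fun z => h z.rev) ρ' lam' par' αc' βc' κ1' κ0' b)
    (hR' : 0 ≤ RC wA wB wC (fun z => f z.rev) (fun z => g z.rev) (fun z => h z.rev) ρ' lam' par' αc' βc' κ1' κ0') :
    0 ≤ sahiE (W wA wB wC wZ) 3 ![F1 f, F2 g, F3 h] :=
  sahiE_three_nonneg_T1_of_corner hA hB hC hZ0 hZ1 hZ hf0 hfa hfc hg0 hgb hgc hh0 hha hhb
    (cornerQ0_nonneg_of_certificate hA hB hC.nonneg hC.sum_eq_one hf0 hg0 hgb hh0 hhb hρ' hlam' hpar' hα' hβ' hPhi' hR')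
    (cornerQ1_nonneg_of_certificate hA hB hC.nonneg hC.sum_eq_one hf0 hg0 hgb hh0 hhb hρ hlam hpar hα hβ hPhi hR)

end SahiHubCorner

end Summit.CriticalPhenomena.PercolationContinuityZ3.Theorems
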